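import Mathlib.Analysis.Normed.Group.Ultra
import Mathlib.Analysis.Normed.Field.Ultra
import Mathlib.Analysis.SpecificLimits.Normed
import Mathlib.Topology.Algebra.InfiniteSum.NatInt
import Mathlib.Tactic.LinearCombination
import Mathlib.Tactic.Ring
import HarnessLib

/-!
# The ultrametric (`p`-adic) Schwarz lemma for power series with bounded coefficients

Everything in this file is **proved**; there are no definitions.  Let `K` be a complete
non-archimedean (ultrametric) normed field — e.g. `ℚ_p` or `ℂ_p` — and let
`G(z) = ∑ bₙ zⁿ` be a power series with bounded coefficients `‖bₙ‖ ≤ B`, so that `G` converges on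
the open unit disc `‖z‖ < 1` and `‖G(z)‖ ≤ B` there (`norm_tsum_mul_pow_le`).

* `tsum_mul_pow_eq_sub_mul_tsum` (**division by a zero**): if `G(a) = 0` with `‖a‖ < 1` then
  `G(z) = (z - a) · H(z)` on the disc, where `H(z) = ∑ hₙ zⁿ`, `hₙ = ∑_k b_{n+1+k} aᵏ`, again has
  coefficients bounded by `B` (`norm_tsum_shift_mul_pow_le`).
* `norm_tsum_mul_pow_le_mul_prod` (**ultrametric Schwarz lemma**): if `G` vanishes at the points
  of a finite set `s` of the open unit disc, then for every `‖z‖ < 1`,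
  `‖G(z)‖ ≤ B · ∏_{a ∈ s} ‖z - a‖`; in particular (`norm_coeff_zero_le_mul_prod`)
  `‖b₀‖ = ‖G(0)‖ ≤ B · ∏_{a ∈ s} ‖a‖`.

This is the non-archimedean substitute for the Blaschke-factor / maximum-modulus step of
transcendence proofs (the "zero estimate along `q, q², …, q^{S-1}`" in the `p`-adic case of the
Mahler–Manin theorem, Barré-Sirieix–Diaz–Gramain–Philibert 1996; cf. Nesterenko–Philippon
LNM 1752, Ch. 2 §2.5, third step, where the complex case uses Blaschke factors): with integer
coefficients `bₙ ∈ ℤ` one has `B = 1`, and `S - 1` forced zeros at `q, …, q^{S-1}` give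
`‖b_M‖_p ≤ ‖q‖^{S(S-1)/2}`, the same quadratic gain as Jensen's formula.

## References

* A. M. Robert, *A Course in `p`-adic Analysis*, GTM 198, Springer 2000, Ch. 6 §2 (zeros of
  power series, Strassmann's theorem) — the division step is the standard one.
* [NesterenkoPhilippon2001] Yu. V. Nesterenko, P. Philippon (eds.), LNM 1752, Ch. 2 (G. Diaz),
  §2.5, proof of Thm. 2.11, third step (complex analogue).
-/

noncomputable section

open Filter Topology IsUltrametricDist

namespace Literature.NumberTheory.Transcendental

variable {K : Type*} [NontriviallyNormedField K] [IsUltrametricDist K] [CompleteSpace K]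

/-! ### Power series with bounded coefficients on the open unit disc -/

omit [IsUltrametricDist K] in
/-- A power series with bounded coefficients converges on the open unit disc. [folklore] -/
theorem summable_mul_pow_of_norm_le {b : ℕ → K} {B : ℝ} (hb : ∀ n, ‖b n‖ ≤ B) {z : K}
    (hz : ‖z‖ < 1) : Summable fun n ↦ b n * z ^ n := by
  refine Summable.of_norm_bounded
    ((summable_geometric_of_lt_one (norm_nonneg _) hz).mul_left B) fun n ↦ ?_
  rw [norm_mul, norm_pow]
  exact mul_le_mul_of_nonneg_right (hb n) (pow_nonneg (norm_nonneg _) _)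

omit [CompleteSpace K] in
/-- Ultrametric maximum principle, trivial half: `‖∑ bₙ zⁿ‖ ≤ B` for `‖bₙ‖ ≤ B`, `‖z‖ ≤ 1`.
[folklore] -/
theorem norm_tsum_mul_pow_le {b : ℕ → K} {B : ℝ} (hB : 0 ≤ B) (hb : ∀ n, ‖b n‖ ≤ B) {z : K}
    (hz : ‖z‖ ≤ 1) : ‖∑' n, b n * z ^ n‖ ≤ B := by
  refine norm_tsum_le_of_forall_le_of_nonneg hB fun n ↦ ?_
  rw [norm_mul, norm_pow]
  exact (mul_le_of_le_one_right (norm_nonneg _) (pow_le_one₀ (norm_nonneg _) hz)).trans (hb n)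

/-! ### Division by a zero -/

omit [CompleteSpace K] in
/-- The quotient coefficients `hₙ = ∑_k b_{n+1+k} aᵏ` are again bounded by `B`. [folklore] -/
theorem norm_tsum_shift_mul_pow_le {b : ℕ → K} {B : ℝ} (hB : 0 ≤ B) (hb : ∀ n, ‖b n‖ ≤ B)
    {a : K} (ha : ‖a‖ ≤ 1) (n : ℕ) : ‖∑' k, b (n + 1 + k) * a ^ k‖ ≤ B :=
  norm_tsum_mul_pow_le hB (fun k ↦ hb (n + 1 + k)) ha

/-- The recursion behind synthetic division: `∑_k b_{n+k} aᵏ = bₙ + a · ∑_k b_{n+1+k} aᵏ`.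
[folklore] -/
theorem tsum_shift_mul_pow_eq {b : ℕ → K} {B : ℝ} (hb : ∀ n, ‖b n‖ ≤ B) {a : K} (ha : ‖a‖ < 1)
    (n : ℕ) : ∑' k, b (n + k) * a ^ k = b n + a * ∑' k, b (n + 1 + k) * a ^ k := by
  have hs : Summable fun k ↦ b (n + k) * a ^ k :=
    summable_mul_pow_of_norm_le (fun k ↦ hb (n + k)) ha
  rw [hs.tsum_eq_zero_add, ← tsum_mul_left]
  congr 1
  · simp
  · refine tsum_congr fun k ↦ ?_
    rw [pow_succ, show n + (k + 1) = n + 1 + k by ring]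
    ring

/-- **Division by a zero.** If `G(z) = ∑ bₙ zⁿ` has bounded coefficients and `G(a) = 0` with
`‖a‖ < 1`, then `G(z) = (z - a) H(z)` on the open unit disc, with
`H(z) = ∑ₙ (∑_k b_{n+1+k} aᵏ) zⁿ`. [folklore] -/
theorem tsum_mul_pow_eq_sub_mul_tsum {b : ℕ → K} {B : ℝ} (hb : ∀ n, ‖b n‖ ≤ B) {a : K}
    (ha : ‖a‖ < 1) (hGa : ∑' n, b n * a ^ n = 0) {z : K} (hz : ‖z‖ < 1) :
    ∑' n, b n * z ^ n = (z - a) * ∑' n, (∑' k, b (n + 1 + k) * a ^ k) * z ^ n := by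
  have hB : 0 ≤ B := (norm_nonneg _).trans (hb 0)
  set h : ℕ → K := fun n ↦ ∑' k, b (n + 1 + k) * a ^ k with hh
  have hhB : ∀ n, ‖h n‖ ≤ B := fun n ↦ norm_tsum_shift_mul_pow_le hB hb ha.le n
  -- the recursion `b (n+1) = h n - a h (n+1)` and `b 0 = -a h 0`
  have hrec : ∀ n, b (n + 1) = h n - a * h (n + 1) := by
    intro n
    have := tsum_shift_mul_pow_eq hb ha (n + 1)
    simp only [hh]
    linear_combination -this
  have h0 : b 0 = -(a * h 0) := by
    have := tsum_shift_mul_pow_eq hb ha 0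
    simp only [zero_add] at this
    rw [hGa] at this
    simp only [hh, zero_add]
    linear_combination -this
  -- summability of everything in sight
  have hsb : Summable fun n ↦ b n * z ^ n := summable_mul_pow_of_norm_le hb hz
  have hsh : Summable fun n ↦ h n * z ^ n := summable_mul_pow_of_norm_le hhB hz
  -- compute
  rw [hsb.tsum_eq_zero_add, hsh.tsum_eq_zero_add]
  simp only [pow_zero, mul_one]
  rw [h0]
  have h1 : ∑' n, b (n + 1) * z ^ (n + 1) =
      z * ∑' n, h n * z ^ n - a * ∑' n, h (n + 1) * z ^ (n + 1) := by
    rw [← tsum_mul_left, ← tsum_mul_left, ← (hsh.mul_left z).tsum_sub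
      (((summable_nat_add_iff 1).mpr hsh).mul_left a)]
    refine tsum_congr fun n ↦ ?_
    rw [hrec n]
    ring
  rw [h1, hsh.tsum_eq_zero_add]
  simp only [pow_zero, mul_one]
  ring

/-! ### The ultrametric Schwarz lemma -/

/-- **Ultrametric Schwarz lemma.** Let `G(z) = ∑ bₙ zⁿ` with `‖bₙ‖ ≤ B`, and let `s` be a finite
set of points of the open unit disc at which `G` vanishes.  Then `‖G(z)‖ ≤ B ∏_{a ∈ s} ‖z - a‖`
for every `‖z‖ < 1`.  (Divide out the zeros one at a time; each quotient again has
coefficients bounded by `B`, and `‖H(z)‖ ≤ B` by the ultrametric inequality.) [folklore] -/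
theorem norm_tsum_mul_pow_le_mul_prod (s : Finset K) :
    ∀ {b : ℕ → K} {B : ℝ}, (∀ n, ‖b n‖ ≤ B) → (∀ a ∈ s, ‖a‖ < 1) →
      (∀ a ∈ s, ∑' n, b n * a ^ n = 0) → ∀ {z : K}, ‖z‖ < 1 →
        ‖∑' n, b n * z ^ n‖ ≤ B * ∏ a ∈ s, ‖z - a‖ := by
  classical
  induction s using Finset.induction_on with
  | empty =>
    intro b B hb _ _ z hz
    simpa using norm_tsum_mul_pow_le ((norm_nonneg _).trans (hb 0)) hb hz.le
  | insert a s has ih =>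
    intro b B hb hs1 hs0 z hz
    have hB : 0 ≤ B := (norm_nonneg _).trans (hb 0)
    have ha : ‖a‖ < 1 := hs1 a (Finset.mem_insert_self a s)
    have hGa : ∑' n, b n * a ^ n = 0 := hs0 a (Finset.mem_insert_self a s)
    -- divide by the zero `a`
    set h : ℕ → K := fun n ↦ ∑' k, b (n + 1 + k) * a ^ k with hh
    have hhB : ∀ n, ‖h n‖ ≤ B := fun n ↦ norm_tsum_shift_mul_pow_le hB hb ha.le n
    have hdiv : ∀ {w : K}, ‖w‖ < 1 → ∑' n, b n * w ^ n = (w - a) * ∑' n, h n * w ^ n :=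
      fun hw ↦ tsum_mul_pow_eq_sub_mul_tsum hb ha hGa hw
    -- the quotient vanishes on `s`
    have hH0 : ∀ a' ∈ s, ∑' n, h n * a' ^ n = 0 := by
      intro a' ha'
      have hne : a' - a ≠ 0 := sub_ne_zero.mpr (fun h' ↦ has (h' ▸ ha'))
      have h1 := hs0 a' (Finset.mem_insert_of_mem ha')
      rw [hdiv (hs1 a' (Finset.mem_insert_of_mem ha'))] at h1
      exact (mul_eq_zero.mp h1).resolve_left hne
    have hH := ih hhB (fun a' ha' ↦ hs1 a' (Finset.mem_insert_of_mem ha')) hH0 hz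
    rw [hdiv hz, norm_mul, Finset.prod_insert has, ← mul_assoc, mul_comm B, mul_assoc]
    exact mul_le_mul_of_nonneg_left hH (norm_nonneg _)

/-- **Ultrametric Schwarz lemma at the origin**: with the notation of
`norm_tsum_mul_pow_le_mul_prod`, `‖b₀‖ = ‖G(0)‖ ≤ B ∏_{a ∈ s} ‖a‖`.  For integer coefficients
(`B = 1`) and the zeros `q, q², …, q^{S-1}` this reads `‖b₀‖ ≤ ‖q‖^{S(S-1)/2}`. [folklore] -/
theorem norm_coeff_zero_le_mul_prod (s : Finset K) {b : ℕ → K} {B : ℝ} (hb : ∀ n, ‖b n‖ ≤ B)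
    (hs1 : ∀ a ∈ s, ‖a‖ < 1) (hs0 : ∀ a ∈ s, ∑' n, b n * a ^ n = 0) :
    ‖b 0‖ ≤ B * ∏ a ∈ s, ‖a‖ := by
  have h := norm_tsum_mul_pow_le_mul_prod s hb hs1 hs0 (z := 0) (by simp)
  have h0 : ∑' n, b n * (0 : K) ^ n = b 0 := by
    rw [tsum_eq_single 0 fun n hn ↦ by simp [hn]]
    simp
  simpa [h0] using h

/-- The geometric-progression case used in transcendence proofs: if `G(z) = ∑ bₙ zⁿ`,
`‖bₙ‖ ≤ B`, vanishes at `q, q², …, q^m` with `0 < ‖q‖ < 1`, then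
`‖b₀‖ ≤ B · ‖q‖^{m(m+1)/2}`. [folklore] -/
theorem norm_coeff_zero_le_mul_pow_of_forall_pow {b : ℕ → K} {B : ℝ} (hb : ∀ n, ‖b n‖ ≤ B)
    {q : K} (hq0 : q ≠ 0) (hq1 : ‖q‖ < 1) {m : ℕ}
    (hzero : ∀ i < m, ∑' n, b n * (q ^ (i + 1)) ^ n = 0) :
    ‖b 0‖ ≤ B * ‖q‖ ^ (m * (m + 1) / 2) := by
  classical
  have hnq : 0 < ‖q‖ := norm_pos_iff.mpr hq0
  have hinj : Set.InjOn (fun i : ℕ ↦ q ^ (i + 1)) (Finset.range m : Set ℕ) := by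
    intro i _ j _ hij
    have h := congrArg norm hij
    simp only [norm_pow] at h
    have := pow_right_injective₀ hnq hq1.ne h
    omega
  have h := norm_coeff_zero_le_mul_prod ((Finset.range m).image fun i ↦ q ^ (i + 1)) hb
    (fun a ha ↦ by
      obtain ⟨i, -, rfl⟩ := Finset.mem_image.mp ha
      rw [norm_pow]
      exact pow_lt_one₀ (norm_nonneg _) hq1 (Nat.succ_ne_zero i))
    (fun a ha ↦ by
      obtain ⟨i, hi, rfl⟩ := Finset.mem_image.mp ha
      exact hzero i (Finset.mem_range.mp hi))
  rw [Finset.prod_image hinj] at h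
  simp only [norm_pow, Finset.prod_pow_eq_pow_sum] at h
  have hsum : ∑ i ∈ Finset.range m, (i + 1) = m * (m + 1) / 2 := by
    have h1 := Finset.sum_range_succ' (fun i ↦ i) m
    have h2 := Finset.sum_range_id (m + 1)
    simp only [add_zero, Nat.add_sub_cancel] at h1 h2
    rw [← h1, h2, Nat.mul_comm]
  rwa [hsum] at h

end Literature.NumberTheory.Transcendental

end
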